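import Literature.NumberTheory.Weil1964.AdelicSecondDegreeCharacter
import Literature.RepresentationTheory.HeisenbergGroup.LocalWeilProjective
import Literature.Analysis.Fourier.InversionCompactQuotient
import Mathlib.RepresentationTheory.Subrepresentation
import HarnessLib

/-!
# The adelic Heisenberg group and the global Schrödinger representation on `𝒮(𝔸_F^ι)`

Origin: `pub-hodgecm` MODEL-CONSTRUCTION sub-cell, node **W2/W4** (global Weil representation), file W2-glob-1
(construction prover `mc-weil-2-g2`).  KERNEL MATHEMATICS ONLY: no `def … : Prop` records, no `axiom`, no
proof hole; every `[cite: …]` / `[folklore]` tag below is provenance for a kernel-checked statement.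

This file builds the CARRIERS that [GelbartRogawski1991, §3.1 p. 454] quantifies over ("let `ρ_ψ` be an
irreducible unitary representation of `H_𝐀(W)` with central character `ψ` … the global metaplectic group
`Mp_𝐀(W)` is the group of pairs `(g, M_g)` … such that `M_g ρ_ψ(h) M_g⁻¹ = ρ_ψ(g(h))` for all `h ∈ H(𝐀)`"),
in the tree's concrete smooth model: the adelic Schwartz–Bruhat space
`𝒮(𝔸_F^ι) = piSchwartzBruhat F ι` of `AdelicPiSchwartzBruhatFourier.lean` (the space on which the theta
distribution `Θ` of `AdelicThetaDistribution.lean` lives), acted on by the ADELIC HEISENBERG GROUP of the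
standard polarisation `W = X ⊕ X^*`, `X = F^ι`, through Weil's operators
`U(w)Φ(u) = Φ(u + x) ψ(⟨u, y⟩)` [Weil1964, Chap. I n° 4 p. 149] — weil-1's generic `schrodinger β ψ`
(`SchrodingerModel.lean`, any commutative ring) at `R = 𝔸_F`, `β = ` the dot product, `ψ = ψ_F = adeleAddChar F`.

* §1 TRANSLATIONS `translate x Φ = Φ(· + x)`, `x ∈ 𝔸_F^ι`, preserve `𝒮(𝔸_F^ι)` (`translate_mem`; archimedean
  factor: Mathlib `SchwartzMap.compSubConstCLM`; finite factor: a translate of a locally constant compactly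
  supported function is such);
* §2 MODULATIONS `mulChar y Φ = ψ_F(⟨·, y⟩) Φ`, `y ∈ 𝔸_F^ι`, preserve `𝒮(𝔸_F^ι)` (`mulChar_mem`; archimedean
  factor `archLinChar` of temperate growth and Mathlib `SchwartzMap.smulLeftCLM`; finite factor locally constant,
  `isLocallyConstant_finiteAdeleAddChar` of F2; splitting `linChar_eq_mul` from the tree's
  `adeleAddChar_sum_mul_piAdeleSplit`);
* §3 the ADELIC HEISENBERG GROUP `AdelicHeisenberg F ι = Heisenberg (polar (adelicForm F ι))` of
  `W_𝔸 = 𝔸_F^ι × 𝔸_F^ι` with `adelicForm = ` the dot product, the stability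
  `schrodinger_mem_piSchwartzBruhat` and **`adelicSchrodinger F ι : Representation ℂ (AdelicHeisenberg F ι)
  (piSchwartzBruhat F ι)`** — GR91's `ρ_ψ` on its smooth vectors [MoeglinVignerasWaldspurger1987, Chap. 2 I.4
  Exemple (1)] — with its formulas, the central character `ψ_F` (`adelicSchrodinger_ofCenter`) and the
  TRIVIALITY ON THE RATIONAL CENTRE (`adelicSchrodinger_ofCenter_algebraMap`); the global metaplectic group of
  pairs is then weil-1's `MpPsi (adelicSchrodinger F ι)` (`LocalWeilProjective.lean`), no new definition;
* §4 **THETA SEPARATION** (the uniqueness half of [Weil1964, Chap. III n° 41 Thm 6 p. 193] in the form the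
  model needs it): `Θ(ρ((x,y),0)Φ) = Σ_ξ Φ(ξ + x) ψ_F(⟨ξ, y⟩)` is an absolutely convergent character series on the
  compact quotient `𝔸_F^ι / F^ι` (`thetaDist_adelicSchrodinger_ofVec`), so by uniqueness of Fourier
  coefficients (`eq_zero_of_forall_tsum_mul_addChar_eq_zero`, from the tree's `integral_conj_addChar_mul_tsum`)
  **two Schwartz–Bruhat functions with the same theta lift `h ↦ Θ(ρ(h)Φ)` are equal**
  (`eq_of_forall_thetaDist_adelicSchrodinger_eq`), and an endomorphism of `𝒮(𝔸_F^ι)` commuting with the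
  Heisenberg translations and modulations and fixing `Θ` is the identity (`eq_id_of_commute_of_thetaDist_eq`).
  Consequence used downstream (W2-glob-2): an element `g ∈ Sp(W_𝔸)` has AT MOST ONE implementer `M_g` on
  `𝒮(𝔸_F^ι)` fixing `Θ` — Weil's lift `r_F` / GR91's splitting `i` over `Sp_F(W)` is choice-free.

## References

* [Weil1964] A. Weil, *Sur certains groupes d'opérateurs unitaires*, Acta Math. 111 (1964) 143–211, Chap. I
  n° 4 p. 149 (the operators `U(w)`), n°s 34–37 pp. 182–188 (the adelic standard groups), Chap. III n° 41 Thm 6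
  p. 193.
* [MoeglinVignerasWaldspurger1987] C. Mœglin, M.-F. Vignéras, J.-L. Waldspurger, *Correspondances de Howe sur un
  corps p-adique*, LNM 1291 (1987), Chap. 2 I.2, I.4 Exemple (1), II.1.
* [GelbartRogawski1991] S. Gelbart, J. Rogawski, *L-functions and Fourier–Jacobi coefficients for the unitary
  group U(3)*, Invent. math. 105 (1991) 445–472, §3.1 p. 454.
* [CasselsFrohlichANT1967] J. Tate, Fourier analysis in number fields …, Ch. XV Lemma 4.2.1 (uniqueness of
  Fourier coefficients on a compact quotient).
-/

set_option autoImplicit false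

noncomputable section

open scoped BigOperators NNReal Matrix Topology FourierTransform SchwartzMap Classical ComplexConjugate
open NumberField NumberField.mixedEmbedding IsDedekindDomain MeasureTheory

namespace Literature.NumberTheory.Weil1964

open Literature.NumberTheory.Automorphic Literature.RepresentationTheory.HeisenbergGroup

/-! ### §0 Uniqueness of the coefficients of an absolutely convergent character series on a compact group -/

section Uniqueness

variable {C : Type*} [AddCommGroup C] [TopologicalSpace C] [IsTopologicalAddGroup C] [CompactSpace C]
  {Ξ : Type*} [AddCommGroup Ξ] [Countable Ξ] (χ : Ξ →+ AddChar C Circle)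

/-- **Uniqueness of Fourier coefficients** on a compact abelian group: if `χ : Ξ → Ĉ` is an injective family of
continuous characters, `Σ_ξ |c_ξ| < ∞` and `Σ_ξ c_ξ χ_ξ(u) = 0` for every `u`, then `c = 0` (integrate against
`conj χ_η` for the Haar probability measure: Tate's Lemma 4.2.1, the tree's `integral_conj_addChar_mul_tsum`).
[cite: CasselsFrohlichANT1967, Ch. XV Lemma 4.2.1] -/
theorem eq_zero_of_forall_tsum_mul_addChar_eq_zero (hχi : Function.Injective χ)
    (hχc : ∀ ξ, Continuous fun u : C => (χ ξ u : ℂ)) {c : Ξ → ℂ} (hc : Summable fun ξ => ‖c ξ‖)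
    (h0 : ∀ u : C, ∑' ξ, c ξ * (χ ξ u : ℂ) = 0) : c = 0 := by
  letI : MeasurableSpace C := borel C
  haveI : BorelSpace C := ⟨rfl⟩
  set m : Measure C := Measure.addHaarMeasure ⊤ with hm
  haveI : IsProbabilityMeasure m := ⟨by rw [hm]; exact Measure.addHaarMeasure_self⟩
  funext η
  have h := Literature.Analysis.Fourier.integral_conj_addChar_mul_tsum m χ hχi hχc hc η
  have h' : (fun u : C => conj (χ η u : ℂ) * ∑' ξ, c ξ * (χ ξ u : ℂ)) = fun _ => 0 := by
    funext u
    rw [h0 u, mul_zero]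
  rw [h', integral_zero] at h
  exact h.symm

end Uniqueness

variable (F : Type) [Field F] [NumberField F] (ι : Type)

/-! ### §1 Translations preserve `𝒮(𝔸_F^ι)` -/

section Translate

variable {ι}

/-- The translate `Φ(· + x)` of a function on `𝔸_F^ι` (Weil's `U(u, 0)Φ(x) = Φ(x + u)`).
[cite: Weil1964, Chap. I n° 4 p. 149] -/
def translate (x : ι → AdeleRing (𝓞 F) F) (Φ : (ι → AdeleRing (𝓞 F) F) → ℂ) : (ι → AdeleRing (𝓞 F) F) → ℂ :=
  fun u => Φ (u + x)

variable {F}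

/-- Pointwise formula. [folklore] -/
@[simp] theorem translate_apply (x : ι → AdeleRing (𝓞 F) F) (Φ : (ι → AdeleRing (𝓞 F) F) → ℂ)
    (u : ι → AdeleRing (𝓞 F) F) : translate F x Φ u = Φ (u + x) := rfl

/-- `translate x 0 = 0`. [folklore] -/
@[simp] theorem translate_zero_fun (x : ι → AdeleRing (𝓞 F) F) :
    translate F x (0 : (ι → AdeleRing (𝓞 F) F) → ℂ) = 0 := rfl

/-- additivity in the function. [folklore] -/
theorem translate_add_fun (x : ι → AdeleRing (𝓞 F) F) (Φ Ψ : (ι → AdeleRing (𝓞 F) F) → ℂ) :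
    translate F x (Φ + Ψ) = translate F x Φ + translate F x Ψ := rfl

/-- homogeneity in the function. [folklore] -/
theorem translate_smul_fun (x : ι → AdeleRing (𝓞 F) F) (c : ℂ) (Φ : (ι → AdeleRing (𝓞 F) F) → ℂ) :
    translate F x (c • Φ) = c • translate F x Φ := rfl

variable [Fintype ι]

/-- A translate of a factorizable Schwartz–Bruhat function is factorizable Schwartz–Bruhat: translate the
archimedean factor (Mathlib `SchwartzMap.compSubConstCLM`) and the finite factor (locally constant and compactly
supported functions are stable under translation). [folklore] -/
theorem isFactorizablePiSchwartzBruhat_translate {Φ : (ι → AdeleRing (𝓞 F) F) → ℂ}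
    (h : IsFactorizablePiSchwartzBruhat F ι Φ) (x : ι → AdeleRing (𝓞 F) F) :
    IsFactorizablePiSchwartzBruhat F ι (translate F x Φ) := by
  obtain ⟨Φinf, Φfin, hfin, rfl⟩ := h
  obtain ⟨hlc, hcs⟩ := (mem_schwartzBruhat_iff).1 hfin
  refine ⟨SchwartzMap.compSubConstCLM ℂ (-(piArch F ι x)) Φinf, fun b => Φfin (b + piFinite F ι x), ?_,
    funext fun u => ?_⟩
  · have htr : (fun b => Φfin (b + piFinite F ι x)) = Φfin ∘ Homeomorph.addRight (piFinite F ι x) := rfl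
    refine (mem_schwartzBruhat_iff).2 ⟨?_, ?_⟩
    · rw [htr]; exact hlc.comp_continuous (Homeomorph.addRight _).continuous
    · rw [htr]; exact hcs.comp_homeomorph (Homeomorph.addRight _)
  · rw [translate_apply, SchwartzMap.compSubConstCLM_apply, piArch_add, piFinite_add, sub_neg_eq_add]

/-- **`𝒮(𝔸_F^ι)` is stable under translations** by `x ∈ 𝔸_F^ι` (span induction from the factorizable case).
[cite: Weil1964, Chap. I n° 4 p. 149] -/
theorem translate_mem {Φ : (ι → AdeleRing (𝓞 F) F) → ℂ} (hΦ : Φ ∈ piSchwartzBruhat F ι)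
    (x : ι → AdeleRing (𝓞 F) F) : translate F x Φ ∈ piSchwartzBruhat F ι := by
  induction hΦ using Submodule.span_induction with
  | mem Φ h => exact mem_piSchwartzBruhat (isFactorizablePiSchwartzBruhat_translate h x)
  | zero => exact zero_mem _
  | add Φ Ψ _ _ ihΦ ihΨ =>
    rw [translate_add_fun]
    exact add_mem ihΦ ihΨ
  | smul c Φ _ ih =>
    rw [translate_smul_fun]
    exact Submodule.smul_mem _ c ih

end Translate

/-! ### §2 Modulations by the characters `ψ_F(⟨u, y⟩)` preserve `𝒮(𝔸_F^ι)` -/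

section Modulate

variable {ι} [Fintype ι]

/-- The character `u ↦ ψ_F(⟨u, y⟩) = ψ_F(Σ_i u_i y_i)` of `𝔸_F^ι` attached to `y ∈ 𝔸_F^ι`, as a complex number
(Weil's `⟨x, x*⟩` for the standard self-duality of `𝔸_F^ι`). [cite: Weil1964, Chap. I n° 4 p. 149] -/
def linChar (y : ι → AdeleRing (𝓞 F) F) (u : ι → AdeleRing (𝓞 F) F) : ℂ :=
  ((adeleAddChar F (u ⬝ᵥ y) : Circle) : ℂ)

variable {F}

/-- Unfolding. [folklore] -/
theorem linChar_apply (y u : ι → AdeleRing (𝓞 F) F) : linChar F y u = ((adeleAddChar F (u ⬝ᵥ y) : Circle) : ℂ) :=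
  rfl

/-- `|ψ_F(⟨u, y⟩)| = 1`. [folklore] -/
@[simp] theorem norm_linChar (y u : ι → AdeleRing (𝓞 F) F) : ‖linChar F y u‖ = 1 :=
  Circle.norm_coe _

variable (F) in
/-- The archimedean factor `a ↦ 𝐞(-⟨a, w⟩) = exp(-2πi Σ_i Tr(a_i w_i))` (`w ∈ (F ⊗ ℝ)^ι`; Tate's sign
convention `ψ_∞(y) = exp(-2πi Tr y)`). [folklore] -/
def archLinChar (w : ι → mixedSpace F) (a : ι → mixedSpace F) : ℂ :=
  ((𝐞 (-(piTracePairing F ι a w)) : Circle) : ℂ)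

/-- Unfolding. [folklore] -/
theorem archLinChar_apply (w a : ι → mixedSpace F) :
    archLinChar F w a = ((𝐞 (-(piTracePairing F ι a w)) : Circle) : ℂ) := rfl

/-- `a ↦ ⟨a, w⟩` is a (continuous) linear functional of the finite-dimensional real space `(F ⊗ ℝ)^ι`, hence of
temperate growth. [folklore] -/
theorem hasTemperateGrowth_piTracePairing_left (w : ι → mixedSpace F) :
    Function.HasTemperateGrowth fun a : ι → mixedSpace F => piTracePairing F ι a w := by
  have h : (fun a : ι → mixedSpace F => piTracePairing F ι a w) =
      ⇑(LinearMap.toContinuousLinearMap ((piTracePairing F ι).flip w)) := by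
    funext a
    rfl
  rw [h]
  exact (LinearMap.toContinuousLinearMap ((piTracePairing F ι).flip w)).hasTemperateGrowth

/-- **The archimedean linear characters have temperate growth.** [folklore] -/
theorem hasTemperateGrowth_archLinChar (w : ι → mixedSpace F) : (archLinChar F w).HasTemperateGrowth :=
  hasTemperateGrowth_fourierChar_coe.comp (hasTemperateGrowth_piTracePairing_left w).neg

variable (F) in
/-- Multiplication by `𝐞(-⟨·, w⟩)` as a continuous endomorphism of `𝓢((F ⊗ ℝ)^ι, ℂ)` (Mathlib
`SchwartzMap.smulLeftCLM`). [folklore] -/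
def archLinCharCLM (w : ι → mixedSpace F) : 𝓢((ι → mixedSpace F), ℂ) →L[ℂ] 𝓢((ι → mixedSpace F), ℂ) :=
  SchwartzMap.smulLeftCLM ℂ (archLinChar F w)

/-- Unfolding of `archLinCharCLM`. [folklore] -/
@[simp] theorem archLinCharCLM_apply (w : ι → mixedSpace F) (Φ : 𝓢((ι → mixedSpace F), ℂ))
    (a : ι → mixedSpace F) : archLinCharCLM F w Φ a = archLinChar F w a * Φ a :=
  SchwartzMap.smulLeftCLM_apply_apply (hasTemperateGrowth_archLinChar w) Φ a

variable (F) in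
/-- The finite factor `b ↦ ψ_f(Σ_i c_i b_i)` (`c ∈ (𝔸_F^∞)^ι`). [folklore] -/
def finLinChar (c : ι → FiniteAdeleRing (𝓞 F) F) (b : ι → FiniteAdeleRing (𝓞 F) F) : ℂ :=
  ((finiteAdeleAddChar F (∑ i, c i * b i) : Circle) : ℂ)

/-- Unfolding. [folklore] -/
theorem finLinChar_apply (c b : ι → FiniteAdeleRing (𝓞 F) F) :
    finLinChar F c b = ((finiteAdeleAddChar F (∑ i, c i * b i) : Circle) : ℂ) := rfl

/-- The finite linear characters are locally constant (`ψ_f` is, F2). [folklore] -/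
theorem isLocallyConstant_finLinChar (c : ι → FiniteAdeleRing (𝓞 F) F) : IsLocallyConstant (finLinChar F c) :=
  (isLocallyConstant_finiteAdeleAddChar F).comp_continuous
    (continuous_finsetSum _ fun i _ => continuous_const.mul (continuous_apply i))

/-- Multiplication by a finite linear character preserves the Schwartz–Bruhat space of `(𝔸_F^∞)^ι`. [folklore] -/
theorem finLinChar_mul_mem_schwartzBruhat (c : ι → FiniteAdeleRing (𝓞 F) F)
    {Φf : (ι → FiniteAdeleRing (𝓞 F) F) → ℂ} (hΦ : Φf ∈ SchwartzBruhat (ι → FiniteAdeleRing (𝓞 F) F)) :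
    (fun b => finLinChar F c b * Φf b) ∈ SchwartzBruhat (ι → FiniteAdeleRing (𝓞 F) F) := by
  obtain ⟨hlc, hcs⟩ := (mem_schwartzBruhat_iff).1 hΦ
  exact (mem_schwartzBruhat_iff).2 ⟨(isLocallyConstant_finLinChar c).mul hlc, hcs.mul_left⟩

/-- **The character `ψ_F(⟨u, y⟩)` splits** along `𝔸_F^ι ≅ (F ⊗ ℝ)^ι × (𝔸_F^∞)^ι`:
`ψ_F(⟨u, y⟩) = 𝐞(-⟨u_∞, y_∞⟩) ψ_f(Σ_i y_{i,f} u_{i,f})` (the tree's `adeleAddChar_sum_mul_piAdeleSplit`).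
[folklore] -/
theorem linChar_eq_mul (y u : ι → AdeleRing (𝓞 F) F) :
    linChar F y u = archLinChar F (piArch F ι y) (piArch F ι u) * finLinChar F (piFinite F ι y) (piFinite F ι u) := by
  have h := adeleAddChar_sum_mul_piAdeleSplit (K := F) (ι := ι) y ((piAdeleSplit F ι).symm u)
  rw [ContinuousAddEquiv.apply_symm_apply, piAdeleSplit_symm_apply] at h
  rw [linChar_apply, dotProduct_comm, dotProduct, h, archLinChar_apply, finLinChar_apply]

variable (F) in
/-- The MODULATION operator `Φ ↦ ψ_F(⟨·, y⟩) Φ` on functions `𝔸_F^ι → ℂ` (Weil's `U(0, u*)Φ(x) = Φ(x)⟨x, u*⟩`).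
[cite: Weil1964, Chap. I n° 4 p. 149] -/
def mulChar (y : ι → AdeleRing (𝓞 F) F) (Φ : (ι → AdeleRing (𝓞 F) F) → ℂ) : (ι → AdeleRing (𝓞 F) F) → ℂ :=
  fun u => linChar F y u * Φ u

/-- Pointwise formula. [folklore] -/
@[simp] theorem mulChar_apply (y : ι → AdeleRing (𝓞 F) F) (Φ : (ι → AdeleRing (𝓞 F) F) → ℂ)
    (u : ι → AdeleRing (𝓞 F) F) : mulChar F y Φ u = linChar F y u * Φ u := rfl

/-- `mulChar y 0 = 0`. [folklore] -/
@[simp] theorem mulChar_zero_fun (y : ι → AdeleRing (𝓞 F) F) :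
    mulChar F y (0 : (ι → AdeleRing (𝓞 F) F) → ℂ) = 0 := by
  funext u; simp

/-- additivity in the function. [folklore] -/
theorem mulChar_add_fun (y : ι → AdeleRing (𝓞 F) F) (Φ Ψ : (ι → AdeleRing (𝓞 F) F) → ℂ) :
    mulChar F y (Φ + Ψ) = mulChar F y Φ + mulChar F y Ψ := by
  funext u; simp [mul_add]

/-- homogeneity in the function. [folklore] -/
theorem mulChar_smul_fun (y : ι → AdeleRing (𝓞 F) F) (c : ℂ) (Φ : (ι → AdeleRing (𝓞 F) F) → ℂ) :
    mulChar F y (c • Φ) = c • mulChar F y Φ := by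
  funext u; simp [mul_left_comm]

/-- A factorizable Schwartz–Bruhat function times `ψ_F(⟨·, y⟩)` is factorizable Schwartz–Bruhat
(`archLinCharCLM` on the archimedean factor, `finLinChar_mul_mem_schwartzBruhat` on the finite one). [folklore] -/
theorem isFactorizablePiSchwartzBruhat_mulChar {Φ : (ι → AdeleRing (𝓞 F) F) → ℂ}
    (h : IsFactorizablePiSchwartzBruhat F ι Φ) (y : ι → AdeleRing (𝓞 F) F) :
    IsFactorizablePiSchwartzBruhat F ι (mulChar F y Φ) := by
  obtain ⟨Φinf, Φfin, hfin, rfl⟩ := h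
  refine ⟨archLinCharCLM F (piArch F ι y) Φinf, fun b => finLinChar F (piFinite F ι y) b * Φfin b,
    finLinChar_mul_mem_schwartzBruhat _ hfin, funext fun u => ?_⟩
  rw [mulChar_apply, archLinCharCLM_apply, linChar_eq_mul]
  ring

/-- **`𝒮(𝔸_F^ι)` is stable under the modulations `ψ_F(⟨·, y⟩)`**, `y ∈ 𝔸_F^ι`.
[cite: Weil1964, Chap. I n° 4 p. 149] -/
theorem mulChar_mem {Φ : (ι → AdeleRing (𝓞 F) F) → ℂ} (hΦ : Φ ∈ piSchwartzBruhat F ι)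
    (y : ι → AdeleRing (𝓞 F) F) : mulChar F y Φ ∈ piSchwartzBruhat F ι := by
  induction hΦ using Submodule.span_induction with
  | mem Φ h => exact mem_piSchwartzBruhat (isFactorizablePiSchwartzBruhat_mulChar h y)
  | zero =>
    rw [mulChar_zero_fun]
    exact zero_mem _
  | add Φ Ψ _ _ ihΦ ihΨ =>
    rw [mulChar_add_fun]
    exact add_mem ihΦ ihΨ
  | smul c Φ _ ih =>
    rw [mulChar_smul_fun]
    exact Submodule.smul_mem _ c ih

end Modulate

/-! ### §3 The adelic Heisenberg group and the global Schrödinger representation -/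

section HeisenbergRep

variable [Fintype ι] [DecidableEq ι]

/-- The bilinear form `β_T(x, y) = ⟨x, T y⟩ = Σ_i x_i (T y)_i` of a matrix `T ∈ M_ι(𝔸_F)` putting `X_𝔸 = 𝔸_F^ι` in
duality with itself (Weil's `[x, x*]`; `T = 1` is the standard dot pairing, a Gram matrix `T` is the polarisation
used by the tree's unitary dual pairs `U(V) ↪ Sp(Res V)`; Mathlib `Matrix.toLinearMap₂'`). REDUCIBLE on purpose:
`symplecticGroup (polar (adelicForm F ι T))` and `symplecticGroup (polar (Matrix.toLinearMap₂' 𝔸_F T))` (the target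
of the tree's `U(V)(𝔸) →* Sp` embeddings) are then the same type up to reducible unfolding.
[cite: Weil1964, Chap. I n° 4 p. 149] -/
abbrev adelicForm (T : Matrix ι ι (AdeleRing (𝓞 F) F)) :
    (ι → AdeleRing (𝓞 F) F) →ₗ[AdeleRing (𝓞 F) F] (ι → AdeleRing (𝓞 F) F) →ₗ[AdeleRing (𝓞 F) F]
      AdeleRing (𝓞 F) F :=
  Matrix.toLinearMap₂' (AdeleRing (𝓞 F) F) T

variable {F ι}

/-- Unfolding: `adelicForm T x y = x ⬝ᵥ (T *ᵥ y)`. [folklore] -/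
@[simp] theorem adelicForm_apply (T : Matrix ι ι (AdeleRing (𝓞 F) F)) (x y : ι → AdeleRing (𝓞 F) F) :
    adelicForm F ι T x y = x ⬝ᵥ (T *ᵥ y) :=
  Matrix.toLinearMap₂'_apply' T x y

/-- The standard dot pairing is `adelicForm 1`. [folklore] -/
theorem adelicForm_one_apply (x y : ι → AdeleRing (𝓞 F) F) : adelicForm F ι 1 x y = x ⬝ᵥ y := by
  rw [adelicForm_apply, Matrix.one_mulVec]

/-- For an invertible Gram matrix `T` (e.g. the adelic image of `T₀ ∈ GL_ι(F)`), `y ↦ T y` is surjective — the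
hypothesis under which theta separation below applies (Mathlib `Matrix.mulVec_surjective_iff_isUnit`). [folklore] -/
theorem mulVec_surjective_of_isUnit {T : Matrix ι ι (AdeleRing (𝓞 F) F)} (hT : IsUnit T) :
    Function.Surjective fun y : ι → AdeleRing (𝓞 F) F => T *ᵥ y :=
  Matrix.mulVec_surjective_iff_isUnit.2 hT

omit [DecidableEq ι] in
/-- `⟨ξ, y⟩ = Σ_i ξ_i y_i` for a principal point `ξ ∈ F^ι` is the tree's `piPairing F ξ y`. [folklore] -/
theorem ratPt_dotProduct (ξ : ι → F) (y : ι → AdeleRing (𝓞 F) F) : ratPt F ι ξ ⬝ᵥ y = piPairing F ξ y := rfl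

variable (F ι)

/-- **The adelic Heisenberg group `H(W_𝔸)`** of the polarised symplectic space `W_𝔸 = X_𝔸 × X_𝔸^*`,
`X = F^ι`, in the duality `β_T`: weil-1's `Heisenberg (polar β)` for `β = adelicForm F ι T` (group law
`(w, t)(w', t') = (w + w', t + t' + ⟨x, T y'⟩)`). [cite: Weil1964, Chap. I n° 4 p. 149] -/
abbrev AdelicHeisenberg (T : Matrix ι ι (AdeleRing (𝓞 F) F)) : Type := Heisenberg (polar (adelicForm F ι T))

variable {F ι}
variable (T : Matrix ι ι (AdeleRing (𝓞 F) F))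

/-- Weil's operator of `h = ((x, y), t)` is `ψ_F(t) · (modulation by ψ_F(⟨·, T y⟩)) ∘ (translation by x)`.
[cite: Weil1964, Chap. I n° 4 p. 149] -/
theorem schrodinger_adelic_eq (h : AdelicHeisenberg F ι T) (Φ : (ι → AdeleRing (𝓞 F) F) → ℂ) :
    schrodinger (adelicForm F ι T) (adeleAddChar F) h Φ =
      ((adeleAddChar F h.t : Circle) : ℂ) • mulChar F (T *ᵥ h.v.2) (translate F h.v.1 Φ) := by
  funext u
  rw [schrodinger_apply, Pi.smul_apply, smul_eq_mul, mulChar_apply, translate_apply, linChar_apply,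
    adelicForm_apply, coe_addChar_add, mul_assoc]

/-- **Weil's operators preserve `𝒮(𝔸_F^ι)`** ([Weil1964, n° 11]: `U(w)` induces an automorphism of `𝒮(X)`;
here from `translate_mem` and `mulChar_mem`). [cite: Weil1964, Chap. I n° 11 p. 158] -/
theorem schrodinger_mem_piSchwartzBruhat (h : AdelicHeisenberg F ι T) {Φ : (ι → AdeleRing (𝓞 F) F) → ℂ}
    (hΦ : Φ ∈ piSchwartzBruhat F ι) :
    schrodinger (adelicForm F ι T) (adeleAddChar F) h Φ ∈ piSchwartzBruhat F ι := by
  rw [schrodinger_adelic_eq]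
  exact Submodule.smul_mem _ _ (mulChar_mem (translate_mem hΦ _) _)

variable (F ι)

/-- `𝒮(𝔸_F^ι)` as a SUBREPRESENTATION of the Schrödinger representation of `H(W_𝔸)` on all functions
`𝔸_F^ι → ℂ` (Mathlib `Subrepresentation`). [cite: MoeglinVignerasWaldspurger1987, Chap. 2 I.4 Exemple (1)] -/
def adelicSchrodingerSub : Subrepresentation (schrodinger (adelicForm F ι T) (adeleAddChar F)) where
  toSubmodule := piSchwartzBruhat F ι
  apply_mem_toSubmodule h _ hΦ := schrodinger_mem_piSchwartzBruhat T h hΦ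

/-- **THE GLOBAL SCHRÖDINGER REPRESENTATION `ρ_ψ` of the adelic Heisenberg group on `𝒮(𝔸_F^ι)`** — the
smooth model of [GelbartRogawski1991, §3.1 p. 454]'s `ρ_ψ` ("an irreducible unitary representation of `H_𝐀(W)`
with central character `ψ`"), realised as in [MoeglinVignerasWaldspurger1987, Chap. 2 I.4 Exemple (1)] on
Schwartz–Bruhat functions on the Lagrangian `X_𝔸`: `(ρ((x,y),t)Φ)(u) = ψ_F(t + ⟨u, T y⟩) Φ(u + x)`.
[cite: MoeglinVignerasWaldspurger1987, Chap. 2 I.4 Exemple (1)] -/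
def adelicSchrodinger : Representation ℂ (AdelicHeisenberg F ι T) (piSchwartzBruhat F ι) :=
  (adelicSchrodingerSub F ι T).toRepresentation

variable {F ι}

/-- The global Schrödinger representation is the restriction of weil-1's `schrodinger`: coercion formula.
[cite: MoeglinVignerasWaldspurger1987, Chap. 2 I.4 Exemple (1)] -/
@[simp] theorem coe_adelicSchrodinger (h : AdelicHeisenberg F ι T) (Φ : piSchwartzBruhat F ι) :
    ((adelicSchrodinger F ι T h Φ : piSchwartzBruhat F ι) : (ι → AdeleRing (𝓞 F) F) → ℂ) =
      schrodinger (adelicForm F ι T) (adeleAddChar F) h Φ := rfl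

/-- Pointwise formula `(ρ((x,y),t)Φ)(u) = ψ_F(t + ⟨u, T y⟩) Φ(u + x)`.
[cite: MoeglinVignerasWaldspurger1987, Chap. 2 I.4 Exemple (1)] -/
theorem adelicSchrodinger_apply (h : AdelicHeisenberg F ι T) (Φ : piSchwartzBruhat F ι) (u : ι → AdeleRing (𝓞 F) F) :
    ((adelicSchrodinger F ι T h Φ : piSchwartzBruhat F ι) : (ι → AdeleRing (𝓞 F) F) → ℂ) u =
      ((adeleAddChar F (h.t + u ⬝ᵥ (T *ᵥ h.v.2)) : Circle) : ℂ) * (Φ : (ι → AdeleRing (𝓞 F) F) → ℂ) (u + h.v.1) := by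
  rw [coe_adelicSchrodinger, schrodinger_apply, adelicForm_apply]

/-- **Central character**: the centre `{((0,0),t)}` acts by `ψ_F(t)`.
[cite: MoeglinVignerasWaldspurger1987, Chap. 2 I.2] -/
theorem adelicSchrodinger_ofCenter (t : AdeleRing (𝓞 F) F) (Φ : piSchwartzBruhat F ι) :
    adelicSchrodinger F ι T (Heisenberg.ofCenter (polar (adelicForm F ι T)) (Multiplicative.ofAdd t)) Φ =
      ((adeleAddChar F t : Circle) : ℂ) • Φ := by
  apply Subtype.ext
  rw [coe_adelicSchrodinger, schrodinger_ofCenter]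
  rfl

/-- **The rational centre acts trivially**: `ρ((0,0),t) = 1` for `t ∈ F` (`ψ_F` is trivial on `F`, Tate's
Lemma 4.1.5) — so `ρ_ψ` restricted to `H(W_F)` factors through `H(W_F)/F`. [folklore] -/
theorem adelicSchrodinger_ofCenter_algebraMap (k : F) (Φ : piSchwartzBruhat F ι) :
    adelicSchrodinger F ι T (Heisenberg.ofCenter (polar (adelicForm F ι T))
      (Multiplicative.ofAdd (algebraMap F (AdeleRing (𝓞 F) F) k))) Φ = Φ := by
  rw [adelicSchrodinger_ofCenter, adeleAddChar_algebraMap, Circle.coe_one, one_smul]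

/-- `X_𝔸 × 0 × 0` acts by translations. [cite: Weil1964, Chap. I n° 4 p. 149] -/
theorem coe_adelicSchrodinger_ofVec_inl (x : ι → AdeleRing (𝓞 F) F) (Φ : piSchwartzBruhat F ι) :
    ((adelicSchrodinger F ι T (Heisenberg.ofVec (polar (adelicForm F ι T)) (x, 0)) Φ : piSchwartzBruhat F ι) :
        (ι → AdeleRing (𝓞 F) F) → ℂ) = translate F x Φ := by
  funext u
  rw [coe_adelicSchrodinger, schrodinger_ofVec_inl, translate_apply]

/-- `0 × X_𝔸^* × 0` acts by modulations `ψ_F(⟨·, T y⟩)`. [cite: Weil1964, Chap. I n° 4 p. 149] -/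
theorem coe_adelicSchrodinger_ofVec_inr (y : ι → AdeleRing (𝓞 F) F) (Φ : piSchwartzBruhat F ι) :
    ((adelicSchrodinger F ι T (Heisenberg.ofVec (polar (adelicForm F ι T)) (0, y)) Φ : piSchwartzBruhat F ι) :
        (ι → AdeleRing (𝓞 F) F) → ℂ) = mulChar F (T *ᵥ y) Φ := by
  funext u
  rw [coe_adelicSchrodinger, schrodinger_ofVec_inr, mulChar_apply, linChar_apply, adelicForm_apply]

/-- `ρ((x,y),0)Φ = ψ_F(⟨·, T y⟩) Φ(· + x)`. [cite: Weil1964, Chap. I n° 4 p. 149] -/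
theorem coe_adelicSchrodinger_ofVec (x y : ι → AdeleRing (𝓞 F) F) (Φ : piSchwartzBruhat F ι) :
    ((adelicSchrodinger F ι T (Heisenberg.ofVec (polar (adelicForm F ι T)) (x, y)) Φ : piSchwartzBruhat F ι) :
        (ι → AdeleRing (𝓞 F) F) → ℂ) = mulChar F (T *ᵥ y) (translate F x Φ) := by
  rw [coe_adelicSchrodinger, schrodinger_adelic_eq, Heisenberg.ofVec_t, AddChar.map_zero_eq_one, Circle.coe_one,
    one_smul, Heisenberg.ofVec_v]

end HeisenbergRep

/-! ### §4 Theta separation: `Φ` is determined by the theta lift `h ↦ Θ(ρ(h)Φ)` -/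

section ThetaSeparation

variable {F ι} [Fintype ι]

/-- Absolute convergence of `Σ_ξ |Φ(ξ + x)|` for `Φ ∈ 𝒮(𝔸_F^ι)` (theta-1's `summable_norm_thetaFun_term`).
[folklore] -/
theorem summable_norm_apply_ratPt_add {Φ : (ι → AdeleRing (𝓞 F) F) → ℂ} (hΦ : Φ ∈ piSchwartzBruhat F ι)
    (x : ι → AdeleRing (𝓞 F) F) : Summable fun ξ : ι → F => ‖Φ (ratPt F ι ξ + x)‖ := by
  simpa only [add_comm] using summable_norm_thetaFun_term hΦ x

variable [DecidableEq ι] (T : Matrix ι ι (AdeleRing (𝓞 F) F))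

/-- **`Θ(ρ((x,y),0)Φ)` is a character series on `𝔸_F^ι / F^ι` in `y`**:
`Θ(ρ((x,y),0)Φ) = Σ_{ξ ∈ F^ι} Φ(ξ + x) ψ_F(⟨ξ, T y⟩)`, with coefficients the values of `Φ` on the coset `x + F^ι`.
[cite: Weil1964, Chap. III n° 41 p. 193] -/
theorem thetaDist_schrodinger_ofVec (x y : ι → AdeleRing (𝓞 F) F) (Φ : (ι → AdeleRing (𝓞 F) F) → ℂ) :
    thetaDist F ι (schrodinger (adelicForm F ι T) (adeleAddChar F) (Heisenberg.ofVec (polar (adelicForm F ι T)) (x, y)) Φ) =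
      ∑' ξ : ι → F, Φ (ratPt F ι ξ + x) * ((piAdeleChar F ξ (T *ᵥ y) : Circle) : ℂ) := by
  rw [thetaDist_def]
  refine tsum_congr fun ξ => ?_
  rw [schrodinger_apply, Heisenberg.ofVec_t, Heisenberg.ofVec_v, zero_add, adelicForm_apply, ratPt_dotProduct,
    piAdeleChar_apply, mul_comm]

/-- The same for the global Schrödinger representation on `𝒮(𝔸_F^ι)`. [cite: Weil1964, Chap. III n° 41 p. 193] -/
theorem thetaDist_adelicSchrodinger_ofVec (x y : ι → AdeleRing (𝓞 F) F) (Φ : piSchwartzBruhat F ι) :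
    thetaDist F ι (adelicSchrodinger F ι T (Heisenberg.ofVec (polar (adelicForm F ι T)) (x, y)) Φ :
        (ι → AdeleRing (𝓞 F) F) → ℂ) =
      ∑' ξ : ι → F, (Φ : (ι → AdeleRing (𝓞 F) F) → ℂ) (ratPt F ι ξ + x) * ((piAdeleChar F ξ (T *ᵥ y) : Circle) : ℂ) := by
  rw [coe_adelicSchrodinger, thetaDist_schrodinger_ofVec]

/-- **THETA SEPARATION.** Two Schwartz–Bruhat functions on `𝔸_F^ι` whose theta lifts
`(x, y) ↦ Θ(ρ((x,y),0)Φ)` agree on `W_𝔸` are equal (for `y ↦ T y` surjective, e.g. `T ∈ GL_ι(F)`): for fixed `x`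
the lift is an absolutely convergent Fourier series on the compact group `𝔸_F^ι / F^ι` in `T y` whose `ξ`-th
coefficient is `Φ(ξ + x)`
(`thetaDist_schrodinger_ofVec`), and Fourier coefficients are unique (`eq_zero_of_forall_tsum_mul_addChar_eq_zero`
for the injective character system `piQuotCharHom` of the tree); `ξ = 0` gives `Φ(x) = Ψ(x)`.  This is the
uniqueness mechanism behind [Weil1964, Chap. III n° 41 Thm 6]: an operator commuting with `ρ(H(W_𝔸))` and
fixing `Θ` is forced. [cite: Weil1964, Chap. III n° 41 Thm 6 p. 193] -/
theorem eq_of_forall_thetaDist_schrodinger_eq (hT : Function.Surjective fun y : ι → AdeleRing (𝓞 F) F => T *ᵥ y)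
    {Φ Ψ : (ι → AdeleRing (𝓞 F) F) → ℂ} (hΦ : Φ ∈ piSchwartzBruhat F ι) (hΨ : Ψ ∈ piSchwartzBruhat F ι)
    (h : ∀ x y : ι → AdeleRing (𝓞 F) F,
      thetaDist F ι (schrodinger (adelicForm F ι T) (adeleAddChar F) (Heisenberg.ofVec (polar (adelicForm F ι T)) (x, y)) Φ) =
        thetaDist F ι (schrodinger (adelicForm F ι T) (adeleAddChar F) (Heisenberg.ofVec (polar (adelicForm F ι T)) (x, y)) Ψ)) :
    Φ = Ψ := by
  haveI : Countable F := NumberField.countable' (K := F)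
  funext x
  -- the coefficients of the difference series
  set c : (ι → F) → ℂ := fun ξ => Φ (ratPt F ι ξ + x) - Ψ (ratPt F ι ξ + x) with hc
  have hΦs : ∀ y : ι → AdeleRing (𝓞 F) F,
      Summable fun ξ : ι → F => Φ (ratPt F ι ξ + x) * ((piAdeleChar F ξ y : Circle) : ℂ) := fun y => by
    refine Summable.of_norm ((summable_norm_apply_ratPt_add hΦ x).congr fun ξ => ?_)
    rw [norm_mul, Circle.norm_coe, mul_one]
  have hΨs : ∀ y : ι → AdeleRing (𝓞 F) F,
      Summable fun ξ : ι → F => Ψ (ratPt F ι ξ + x) * ((piAdeleChar F ξ y : Circle) : ℂ) := fun y => by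
    refine Summable.of_norm ((summable_norm_apply_ratPt_add hΨ x).congr fun ξ => ?_)
    rw [norm_mul, Circle.norm_coe, mul_one]
  have hcs : Summable fun ξ => ‖c ξ‖ :=
    ((summable_norm_apply_ratPt_add hΦ x).add (summable_norm_apply_ratPt_add hΨ x)).of_nonneg_of_le
      (fun _ => norm_nonneg _) fun ξ => norm_sub_le _ _
  -- the difference series vanishes identically on the compact quotient
  have hser : ∀ q : (ι → AdeleRing (𝓞 F) F) ⧸ piPrincipalSubgroup F ι,
      ∑' ξ, c ξ * ((piQuotCharHom F ι ξ q : Circle) : ℂ) = 0 := by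
    intro q
    obtain ⟨y', rfl⟩ := QuotientAddGroup.mk_surjective q
    obtain ⟨y, rfl⟩ := hT y'
    have e : ∀ ξ, c ξ * ((piQuotCharHom F ι ξ (QuotientAddGroup.mk (T *ᵥ y)) : Circle) : ℂ) =
        Φ (ratPt F ι ξ + x) * ((piAdeleChar F ξ (T *ᵥ y) : Circle) : ℂ) -
          Ψ (ratPt F ι ξ + x) * ((piAdeleChar F ξ (T *ᵥ y) : Circle) : ℂ) := fun ξ => by
      rw [piQuotCharHom_apply, piQuotChar_mk, ← piAdeleChar_apply, hc]
      ring
    rw [tsum_congr e, (hΦs (T *ᵥ y)).tsum_sub (hΨs (T *ᵥ y)), ← thetaDist_schrodinger_ofVec,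
      ← thetaDist_schrodinger_ofVec, h x y, sub_self]
  have hc0 := eq_zero_of_forall_tsum_mul_addChar_eq_zero (piQuotCharHom F ι) (piQuotCharHom_injective F ι)
    (fun ξ => continuous_piQuotChar F ξ) hcs hser
  have h0 := congr_fun hc0 0
  rw [hc] at h0
  simpa only [ratPt_zero, zero_add, Pi.zero_apply, sub_eq_zero] using h0

/-- Theta separation for the global Schrödinger representation: `Φ ↦ (h ↦ Θ(ρ(h)Φ))` is injective on
`𝒮(𝔸_F^ι)`. [cite: Weil1964, Chap. III n° 41 Thm 6 p. 193] -/
theorem eq_of_forall_thetaDist_adelicSchrodinger_eq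
    (hT : Function.Surjective fun y : ι → AdeleRing (𝓞 F) F => T *ᵥ y) {Φ Ψ : piSchwartzBruhat F ι}
    (h : ∀ x y : ι → AdeleRing (𝓞 F) F,
      thetaDist F ι (adelicSchrodinger F ι T (Heisenberg.ofVec (polar (adelicForm F ι T)) (x, y)) Φ :
          (ι → AdeleRing (𝓞 F) F) → ℂ) =
        thetaDist F ι (adelicSchrodinger F ι T (Heisenberg.ofVec (polar (adelicForm F ι T)) (x, y)) Ψ :
          (ι → AdeleRing (𝓞 F) F) → ℂ)) :
    Φ = Ψ :=
  Subtype.ext (eq_of_forall_thetaDist_schrodinger_eq T hT Φ.2 Ψ.2 h)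

/-- **RIGIDITY OF `Θ`-FIXING INTERTWINERS.** A linear endomorphism `C` of `𝒮(𝔸_F^ι)` commuting with the
Heisenberg translations and modulations `ρ((x,y),0)` and fixing the theta distribution (`Θ ∘ C = Θ`) is the
identity.  (Hence two implementers `M, M'` of the same `g ∈ Sp(W_𝔸)` on `𝒮(𝔸_F^ι)` that both fix `Θ` are
EQUAL — apply this to `C = M⁻¹M'` — which makes Weil's lift `r_F` of [Weil1964, n° 41 Thm 6] and the splitting
`i : Sp_F(W) → Mp_𝐀(W)` of [GelbartRogawski1991, §3.1 p. 454] choice-free in the tree's model.)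
[cite: Weil1964, Chap. III n° 41 Thm 6 p. 193] -/
theorem eq_id_of_commute_of_thetaDist_eq (hT : Function.Surjective fun y : ι → AdeleRing (𝓞 F) F => T *ᵥ y)
    (C : piSchwartzBruhat F ι →ₗ[ℂ] piSchwartzBruhat F ι)
    (hC : ∀ x y : ι → AdeleRing (𝓞 F) F,
      C ∘ₗ adelicSchrodinger F ι T (Heisenberg.ofVec (polar (adelicForm F ι T)) (x, y)) =
        adelicSchrodinger F ι T (Heisenberg.ofVec (polar (adelicForm F ι T)) (x, y)) ∘ₗ C)
    (hΘ : ∀ Φ : piSchwartzBruhat F ι,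
      thetaDist F ι (C Φ : (ι → AdeleRing (𝓞 F) F) → ℂ) = thetaDist F ι (Φ : (ι → AdeleRing (𝓞 F) F) → ℂ)) :
    C = LinearMap.id := by
  refine LinearMap.ext fun Φ => ?_
  refine eq_of_forall_thetaDist_adelicSchrodinger_eq T hT fun x y => ?_
  have e := LinearMap.congr_fun (hC x y) Φ
  simp only [LinearMap.coe_comp, Function.comp_apply] at e
  rw [LinearMap.id_apply, ← e, hΘ]

end ThetaSeparation

end Literature.NumberTheory.Weil1964
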